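import Mathlib

/-!
# SoloBlindU2Identity — the `U₂` identity of the dihedral (CM) model, in characteristic 2

Kernel certificate for item (G3) of the s101–s109 programme (LAW D / LAW G, solo-blind seat):
in a commutative ring of characteristic `2`, for `σ τ` with `σ * τ = 1` and `Y = σ + τ`,

  `σ * Y ^ (2 ^ (n+1) - 1) = 1 + σ ^ (2 ^ (n+1)) + S n`,

where `S 0 = 0` and `S (n+1) = S n ^ 2 + Y ^ (2 ^ (n+2) - 2)`; unfolded (with `e = n + 2`,
`m = 2 ^ e`): `S = Σ_{k=2}^{e-1} Y ^ (2^(e-1) - 2^(e-k))`, e.g. `Y²` (m = 8), `Y⁴ + Y⁶` (m = 16),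
`Y⁸ + Y¹² + Y¹⁴` (m = 32).

Interpretation: on the CM model of the 2-Eisenstein generalized eigenspace of the supersingular
module at level `2N` (one-generator levels, `m = |Cl(F)[2^∞]|`), `σ` is a generator of the cyclic
2-class group acting on the folded regular module, `Y = T_{l₀}` for a prime `l₀ = λλ̄` with `[λ]`
a generator, and `σ ^ (m/2) = Frob₂`; since `Y ^ (m/2 - 1)` annihilates the folded module, the
identity gives `U₂ - 1 = Σ_{k=2}^{e-1} T_{l₀} ^ (2^(e-1) - 2^(e-k))`, the `U₂` clause of LAW D.
The proof is the three-line induction `S_{e+1} = S_e² + Y^{2^e - 2}`, `(σ Y^M)² + Y^{2M} =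
(σ² + 1) Y^{2M} = σ Y^{2M+1}` (Frobenius in characteristic 2).
-/

namespace Summit.Langlands.Langlands.Theorems

variable {R : Type*} [CommRing R]

/-- The correction sums of the `U₂` identity: `S 0 = 0`, `S (n+1) = S n ^ 2 + Y ^ (2^(n+2) - 2)`. -/
def soloBlindU2Sum (Y : R) : ℕ → R
  | 0 => 0
  | n + 1 => soloBlindU2Sum Y n ^ 2 + Y ^ (2 ^ (n + 2) - 2)

/-- `S 0 = 0`. -/
@[simp] theorem soloBlindU2Sum_zero (Y : R) : soloBlindU2Sum Y 0 = 0 := rfl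

/-- `S (n+1) = S n ^ 2 + Y ^ (2^(n+2) - 2)`. -/
@[simp] theorem soloBlindU2Sum_succ (Y : R) (n : ℕ) :
    soloBlindU2Sum Y (n + 1) = soloBlindU2Sum Y n ^ 2 + Y ^ (2 ^ (n + 2) - 2) := rfl

/-- **The `U₂` identity (G3).** In characteristic `2`, with `σ * τ = 1` and `Y = σ + τ`:
`σ * Y ^ (2^(n+1) - 1) = 1 + σ ^ 2^(n+1) + S n`. -/
theorem soloBlind_U2_identity [CharP R 2] (σ τ : R) (h : σ * τ = 1) (n : ℕ) :
    σ * (σ + τ) ^ (2 ^ (n + 1) - 1) = 1 + σ ^ (2 ^ (n + 1)) + soloBlindU2Sum (σ + τ) n := by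
  have hσY : σ * (σ + τ) = σ ^ 2 + 1 := by linear_combination h
  induction n with
  | zero => norm_num; linear_combination h
  | succ n ih =>
    -- exponent bookkeeping: with a = 2^(n+1) ≥ 1, 2^(n+2) = 2a
    have ha : 1 ≤ 2 ^ (n + 1) := Nat.one_le_two_pow
    have h2 : 2 ^ (n + 2) = 2 * 2 ^ (n + 1) := by rw [pow_succ]; ring
    have e1 : 2 ^ (n + 2) - 1 = (2 ^ (n + 1) - 1) * 2 + 1 := by omega
    have e2 : 2 ^ (n + 2) - 2 = (2 ^ (n + 1) - 1) * 2 := by omega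
    have e3 : 2 ^ (n + 2) = 2 ^ (n + 1) * 2 := by omega
    -- square the induction hypothesis (Frobenius)
    have hsq : (σ * (σ + τ) ^ (2 ^ (n + 1) - 1)) ^ 2
        = (1 + σ ^ (2 ^ (n + 1)) + soloBlindU2Sum (σ + τ) n) ^ 2 := by rw [ih]
    rw [mul_pow, ← pow_mul, CharTwo.add_sq, CharTwo.add_sq, one_pow, ← pow_mul] at hsq
    rw [soloBlindU2Sum_succ, e1, e2, e3]
    linear_combination (σ + τ) ^ ((2 ^ (n + 1) - 1) * 2) * hσY + hsq

/-- Unfolded instances: `m = 8`: `S = Y²`. -/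
theorem soloBlindU2Sum_one (Y : R) : soloBlindU2Sum Y 1 = Y ^ 2 := by
  simp [soloBlindU2Sum]

/-- `m = 16`: `S = Y⁴ + Y⁶`. -/
theorem soloBlindU2Sum_two (Y : R) : soloBlindU2Sum Y 2 = Y ^ 4 + Y ^ 6 := by
  simp [soloBlindU2Sum]; ring

/-- `m = 32`: `S = Y⁸ + Y¹² + Y¹⁴` (characteristic 2 needed for the cross term). -/
theorem soloBlindU2Sum_three [CharP R 2] (Y : R) :
    soloBlindU2Sum Y 3 = Y ^ 8 + Y ^ 12 + Y ^ 14 := by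
  simp [soloBlindU2Sum, CharTwo.add_sq, ← pow_mul]

/-- The `m = 16` case spelled out: `σ Y⁷ = 1 + σ⁸ + Y⁴ + Y⁶`, i.e. on a module killed by `Y⁷`,
`σ⁸ = Frob₂` acts as `1 + Y⁴ + Y⁶` (LAW D at `e = 4`: `U₂ - 1 = T_{l₀}⁴ + T_{l₀}⁶`). -/
theorem soloBlind_U2_identity_sixteen [CharP R 2] (σ τ : R) (h : σ * τ = 1) :
    σ * (σ + τ) ^ 7 = 1 + σ ^ 8 + ((σ + τ) ^ 4 + (σ + τ) ^ 6) := by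
  have := soloBlind_U2_identity σ τ h 2
  rw [soloBlindU2Sum_two] at this
  exact this

end Summit.Langlands.Langlands.Theorems
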